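import Summits.QuantumFields.YangMills.Theorems.BalabanUVNodesN12FarDatumSurgeryB
import Summits.QuantumFields.YangMills.Theorems.BalabanUVNodesN12GaugeLetterLocExplicitLam
import Summits.QuantumFields.YangMills.Theorems.BalabanUVNodesN12GaugeLetterLocExplicitOnZ
import HarnessLib

/-!
# BalabanUVNodes ∕ N12 — THE (σ)_N LETTER OF RECORD WITH ONE DATUM LETTER ON `Z^{(k)}`, AT PRINT's DATUM `Λ(Z) = lamBondsSeq (maxDomT ν.M₁ Z) k` ([Balaban1984PropagatorsII] (2.3)): dag-n12-w6's
# `…N12GaugeLetterLocExplicitOnZ.exists_gaugeLetterLoc_atRecord_explicit_onZ` RE-KEYED — the far-datum surgery is dag-n12-d's `…N12FarDatumSurgeryB.exists_isMinimizer_surgery_far` (print shape,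
# ✓p776507), the explicit letter is O1 (9); the proof text is the parent's — O1 module (10) of the gauge-letter chain (dag-n12-d CEDE ∕ dag-lead WORDS 426∕427∕430, pub-ymgap INBOX 2026-08-30)

[Balaban1984PropagatorsII] = «[II]», (2.3) p. 224; [Balaban1988Convergent] = «[III]», (2.2) p. 255, (2.10)–(2.13) pp. 256–257, (1.3) p. 246; [Balaban1985Variational] = «[15]», (2)–(4) p. 278, Thm 1 p. 279,
(16)–(18) p. 280; [Balaban1985RegularSpaces] (1.7), (1.19) pp. 77–79; [Balaban1985Averaging] Prop. 2 (52)–(53) p. 26.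

Cell `pub-ymgap` (HUMAN RULINGS D-0062 ∕ D-0149), lane `pub-ymgap-dag-n12-c` g37 (R134 seat (a), N12 = [B15], s1, lane owner); `--kind proof --supports` K1⁹ `stmt-QuantumFields-27364` `--as helper`;
count-neutral.  THEOREMS ONLY (0 `def`, 0 `instance`, 0 `sorry`); the parent's capstone with its proof text (tree bytes, `work/gen_onz_lam.py`) and `hmin ↦ IsMinimizerB … (lamBondsSeq …)`, `hu` on
print members, Cin on every bond inside `Z`, suppliers `N12FarDatumSurgery ↦ N12FarDatumSurgeryB` (dag-n12-d) and `…_explicit ↦ …_lamBondsSeq_explicit` (O1 (9)); the parent's §1 `corners_mem_of_sourced`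
REUSED by name.  DECL MAP (old → new): `N12GaugeLetterLocExplicitOnZ.exists_gaugeLetterLoc_atRecord_explicit_onZ ↦ N12GaugeLetterLocExplicitOnZLam.exists_gaugeLetterLoc_atRecord_lamBondsSeq_explicit_onZ`.

HONEST FRAMING.  Composition by name over landed kernel theorems; the minimiser ([15] Thm 1 ∕ (E)), the datum letter on `Z^{(k)}` and the numerics stay HYPOTHESES; nothing of Bałaban's
asserted or refuted beyond cited tree theorems; count-neutral helper (`--supports 27364`); N12 NOT discharged; K0⁷∕K1⁹ NOT closed; counts of record unmoved (typed 28∕28 · discharged 8∕27);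
one finite 𝕋⁴ programme at fixed ε — R4 closes the conditional rung `BalabanLadder.UV` only; the Yang–Mills mass gap (Clay) is NOT proved by any of this; nothing continuum ∕ ℝ⁴ ∕ OS.
-/

noncomputable section

namespace Summit.QuantumFields.YangMills.BalabanUVNodes.N12GaugeLetterLocExplicitOnZLam

open scoped Matrix.Norms.L2Operator BigOperators
open Set
open Literature.MathematicalPhysics.QuantumFieldTheory.Balaban1983to89
open T4Continuum GaugeField B15DeterminingSets B15DeterminingSetsB BlockAveraging
open T4CubeChartGnomonic (SU2)
open B16Sect1Backgrounds (toMS)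
open B14.Eq213MaximalDomains (side)
open B14.Eq213DetSet (Bj maxDomT)
open B14.Eq22Determines (blockIter IsBlockUnion)
open B14DomainGeom (Pt Within)
open B15Eq112TorusCover (cover)
open ExpMeanLog (deltaSU)
open Literature.MathematicalPhysics.QuantumFieldTheory.BalabanImbrieJaffe1984to88.BIJ85Eq453GaugeField (qsstarGIter0)
open Summit.QuantumFields.YangMills.BalabanUVNodes.N12FarDatumSurgeryB (exists_isMinimizer_surgery_far)
open Summit.QuantumFields.YangMills.BalabanUVNodes.N12GaugeLetterLocExplicitOnZ (corners_mem_of_sourced)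
open Summit.QuantumFields.YangMills.BalabanUVNodes.N12GaugeLetterLocExplicitLam (exists_gaugeLetterLoc_atRecord_lamBondsSeq_explicit)

variable {F : T4Family} {Kt k : ℕ} {ν : Node00.Stage7Numerics} {Z : Set (Site (F.P Kt) 0)}

/-! ## The (σ)_N letter of record with one datum letter on `Z^{(k)}`, at print's datum -/

/-- ★★★ **[PRINT's DATUM `Λ(Z)`: `hmin ↦ IsMinimizerB … (lamBondsSeq …)`, `hu` on print members, Cin on EVERY bond inside `Z` (the parent: inputs inside `Z`); surgery by n12-d's `…FarDatumSurgeryB`, the explicit letter by O1 (9).]** ★★★ **THE (σ)_N LETTER OF RECORD, EXPLICIT, CLASS EDITION, DATUM LETTER ON `Z^{(k)}` ONLY** — `N12GaugeLetterLocExplicit.exists_gaugeLetterLoc_atRecord_explicit` with its six region ∕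
shadow binders `𝒞 hD N hGN hN1 hGmem` replaced by ONE letter `hDZ` («the `k`-datum is `ρn`-flat on the `k`-bonds with both ends in `Z^{(k)}`») and `hZblk` (`Z` a union of
`k`-blocks, the record's shape); same level guard ∕ radii ∕ support numerics, same class numerics, SAME residual clause and SAME tolerance in the plaquette clause; the input
clause is stated for the inputs with both ends in `Z`.  PROOF: far-datum surgery (`W′ := W` on `Z^{(k)}`, `1` off it — `ρn`-flat EVERYWHERE; `U′` the surgered minimiser of
`N12FarDatumSurgery.exists_isMinimizer_surgery_far`), the explicit letter at `N = 𝒞 = univ`, and `U′ = U₀` on the bonds the clauses speak about (§1).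
[cite: Balaban1985Variational, (2)–(4) p.278, Thm 1 p.279, (16)–(18) p.280; Balaban1985RegularSpaces, (1.7) p.77, (1.19) p.79; Balaban1985Averaging, Prop. 2 (52)–(53) p.26; Balaban1988Convergent, (2.2) p.255, (2.10)–(2.13) pp.256–257, (1.3) p.246] -/
theorem exists_gaugeLetterLoc_atRecord_lamBondsSeq_explicit_onZ (ν : Node00.Stage7Numerics) (Kt : ℕ) {k : ℕ} (hk0 : 0 < k) (hk : k ≤ (F.P Kt).m + (F.P Kt).K)
    (hdiv : side (F.P Kt).L ν.M₁ k ∣ (F.P Kt).sitesPerDir 0) (Z : Set (Site (F.P Kt) 0)) (hZblk : IsBlockUnion k Z)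
    -- NUMERICS (i): a level guard `k + c ≤ m + K` with `4d + m′ + 3 < 2·L^c` (no wrapping), and `M₁ ≥ (4d + m′)·L² + 2d·L + 12` (radii), `m′ = 3·(d·((L−1)∕2)) + 5`
    {c : ℕ} (hkc : k + c ≤ (F.P Kt).m + (F.P Kt).K) (hc : 4 * (F.P Kt).d + (3 * ((F.P Kt).d * (((F.P Kt).L - 1) / 2)) + 5) + 3 < 2 * (F.P Kt).L ^ c)
    (hMrad : (4 * (F.P Kt).d + (3 * ((F.P Kt).d * (((F.P Kt).L - 1) / 2)) + 5)) * (F.P Kt).L ^ 2 + 2 * (F.P Kt).d * (F.P Kt).L + 12 ≤ ν.M₁)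
    -- THE DATUM LETTER ON `Z^{(k)}` and the minimiser
    {ρn : ℝ} (hρn : 0 ≤ ρn)
    (W : GaugeField (F.P Kt) k SU2) (hDZ : ∀ e : PBond (F.P Kt) k, e.src ∈ pts k Z → e.tgt ∈ pts k Z → dist1 (W e) ≤ ρn)
    {U₀ : GaugeField (F.P Kt) 0 SU2}
    (hmin : IsMinimizerB (Node00.avOfRecord F 2 Kt) (Node00.regMSCoPOfRecord F 2 ν Kt k (maxDomT ν.M₁ Z)) (lamBondsSeq (maxDomT ν.M₁ Z) k)
      (avgFamily (Node00.avOfRecord F 2 Kt) (qsstarGIter0 k W)) U₀)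
    -- the class threshold `εreg`: positive and small ([Balaban1985Averaging] Prop. 2's smallness at `α₀ := εreg·L²`)
    (hεpos : 0 < ν.εreg)
    (hα3 : (143 * (((((F.P Kt).d + 4 : ℕ) : ℝ)) ^ 2 / 4) ^ 2) * (ν.εreg * (F.P Kt).L ^ 2) ≤ 1 / 3)
    (hα2 : 2 * (ν.εreg * (F.P Kt).L ^ 2) ≤ 2 * deltaSU (Fin 2) / ((((F.P Kt).d + 4) * (F.P Kt).L : ℕ) : ℝ) ^ 2)
    (haN : (((((F.P Kt).d + 2) * (F.P Kt).L : ℕ) : ℝ) ^ 2 / 4) * (2 * (ν.εreg * (F.P Kt).L ^ 2)) < deltaSU (Fin 2))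
    -- the family's support numerics: `M₁ ≥ ((d+4)L + 6)·L²`
    (hM₁ : (((F.P Kt).d + 4) * (F.P Kt).L + 6) * (F.P Kt).L ^ 2 ≤ ν.M₁) :
    ∃ σ : GaugeTransf (F.P Kt) 0 SU2,
      (∀ j, j ≤ k → ∀ b ∈ lamBondsSeq (maxDomT ν.M₁ Z) k j, toMS σ j b.src = 1 ∧ toMS σ j b.tgt = 1) ∧
        (∀ p : Plaq (F.P Kt) 0, ((⟨p.src, p.μ⟩ : PBond (F.P Kt) 0) ∈ {b : PBond (F.P Kt) 0 | b.src ∈ maxDomT ν.M₁ Z 1} ∨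
            (⟨p.src.shift p.μ, p.ν⟩ : PBond (F.P Kt) 0) ∈ {b : PBond (F.P Kt) 0 | b.src ∈ maxDomT ν.M₁ Z 1} ∨
            (⟨p.src.shift p.ν, p.μ⟩ : PBond (F.P Kt) 0) ∈ {b : PBond (F.P Kt) 0 | b.src ∈ maxDomT ν.M₁ Z 1} ∨
            (⟨p.src, p.ν⟩ : PBond (F.P Kt) 0) ∈ {b : PBond (F.P Kt) 0 | b.src ∈ maxDomT ν.M₁ Z 1}) →
          ‖((gaugeAct σ U₀ ⟨p.src, p.μ⟩ : SU2) : Matrix (Fin 2) (Fin 2) ℂ) - 1‖ ≤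
              max ρn ((((2 * (∑ i ∈ Finset.range (k + 1), ((F.P Kt).d * (((F.P Kt).L ^ i - 1) / 2) + 1)) + 1 +
                  (3 * ((F.P Kt).d * (((F.P Kt).L - 1) / 2)) + 5) * (F.P Kt).L ^ k : ℕ) : ℝ)) ^ 2 / 4 * (ν.εreg * (F.P Kt).eta 0 ^ 2) +
                ((3 * ((F.P Kt).d * (((F.P Kt).L - 1) / 2)) + 5 : ℕ) : ℝ) * (6 * ((((((F.P Kt).d + 2) * (F.P Kt).L : ℕ) : ℝ) ^ 2 / 4) * (2 * (ν.εreg * (F.P Kt).L ^ 2))) * ∑ i ∈ Finset.range k, ((F.P Kt).L : ℝ) ^ i) + ((3 * ((F.P Kt).d * (((F.P Kt).L - 1) / 2)) + 5 : ℕ) : ℝ) * ρn) ∧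
            ‖((gaugeAct σ U₀ ⟨p.src.shift p.μ, p.ν⟩ : SU2) : Matrix (Fin 2) (Fin 2) ℂ) - 1‖ ≤
              max ρn ((((2 * (∑ i ∈ Finset.range (k + 1), ((F.P Kt).d * (((F.P Kt).L ^ i - 1) / 2) + 1)) + 1 +
                  (3 * ((F.P Kt).d * (((F.P Kt).L - 1) / 2)) + 5) * (F.P Kt).L ^ k : ℕ) : ℝ)) ^ 2 / 4 * (ν.εreg * (F.P Kt).eta 0 ^ 2) +
                ((3 * ((F.P Kt).d * (((F.P Kt).L - 1) / 2)) + 5 : ℕ) : ℝ) * (6 * ((((((F.P Kt).d + 2) * (F.P Kt).L : ℕ) : ℝ) ^ 2 / 4) * (2 * (ν.εreg * (F.P Kt).L ^ 2))) * ∑ i ∈ Finset.range k, ((F.P Kt).L : ℝ) ^ i) + ((3 * ((F.P Kt).d * (((F.P Kt).L - 1) / 2)) + 5 : ℕ) : ℝ) * ρn) ∧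
            ‖((gaugeAct σ U₀ ⟨p.src.shift p.ν, p.μ⟩ : SU2) : Matrix (Fin 2) (Fin 2) ℂ) - 1‖ ≤
              max ρn ((((2 * (∑ i ∈ Finset.range (k + 1), ((F.P Kt).d * (((F.P Kt).L ^ i - 1) / 2) + 1)) + 1 +
                  (3 * ((F.P Kt).d * (((F.P Kt).L - 1) / 2)) + 5) * (F.P Kt).L ^ k : ℕ) : ℝ)) ^ 2 / 4 * (ν.εreg * (F.P Kt).eta 0 ^ 2) +
                ((3 * ((F.P Kt).d * (((F.P Kt).L - 1) / 2)) + 5 : ℕ) : ℝ) * (6 * ((((((F.P Kt).d + 2) * (F.P Kt).L : ℕ) : ℝ) ^ 2 / 4) * (2 * (ν.εreg * (F.P Kt).L ^ 2))) * ∑ i ∈ Finset.range k, ((F.P Kt).L : ℝ) ^ i) + ((3 * ((F.P Kt).d * (((F.P Kt).L - 1) / 2)) + 5 : ℕ) : ℝ) * ρn) ∧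
            ‖((gaugeAct σ U₀ ⟨p.src, p.ν⟩ : SU2) : Matrix (Fin 2) (Fin 2) ℂ) - 1‖ ≤
              max ρn ((((2 * (∑ i ∈ Finset.range (k + 1), ((F.P Kt).d * (((F.P Kt).L ^ i - 1) / 2) + 1)) + 1 +
                  (3 * ((F.P Kt).d * (((F.P Kt).L - 1) / 2)) + 5) * (F.P Kt).L ^ k : ℕ) : ℝ)) ^ 2 / 4 * (ν.εreg * (F.P Kt).eta 0 ^ 2) +
                ((3 * ((F.P Kt).d * (((F.P Kt).L - 1) / 2)) + 5 : ℕ) : ℝ) * (6 * ((((((F.P Kt).d + 2) * (F.P Kt).L : ℕ) : ℝ) ^ 2 / 4) * (2 * (ν.εreg * (F.P Kt).L ^ 2))) * ∑ i ∈ Finset.range k, ((F.P Kt).L : ℝ) ^ i) + ((3 * ((F.P Kt).d * (((F.P Kt).L - 1) / 2)) + 5 : ℕ) : ℝ) * ρn)) ∧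
        (∀ b : PBond (F.P Kt) 0, b.src ∈ Z → b.tgt ∈ Z →
          ‖((gaugeAct σ U₀ b : SU2) : Matrix (Fin 2) (Fin 2) ℂ) - 1‖ ≤
              max ρn ((((2 * (∑ i ∈ Finset.range (k + 1), ((F.P Kt).d * (((F.P Kt).L ^ i - 1) / 2) + 1)) + 1 +
                  (3 * ((F.P Kt).d * (((F.P Kt).L - 1) / 2)) + 5) * (F.P Kt).L ^ k : ℕ) : ℝ)) ^ 2 / 4 * (ν.εreg * (F.P Kt).eta 0 ^ 2) +
                ((3 * ((F.P Kt).d * (((F.P Kt).L - 1) / 2)) + 5 : ℕ) : ℝ) * (6 * ((((((F.P Kt).d + 2) * (F.P Kt).L : ℕ) : ℝ) ^ 2 / 4) * (2 * (ν.εreg * (F.P Kt).L ^ 2))) * ∑ i ∈ Finset.range k, ((F.P Kt).L : ℝ) ^ i) + ((3 * ((F.P Kt).d * (((F.P Kt).L - 1) / 2)) + 5 : ℕ) : ℝ) * ρn)) := by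
  classical
  -- `M₁ ≥ 4` from the radii numerics
  have hM4 : 4 ≤ ν.M₁ := le_trans (by omega) hMrad
  -- the localised datum: `W` on `Z^{(k)}`, `1` off it — `ρn`-flat everywhere
  obtain ⟨W', hWW', hW'⟩ : ∃ W' : GaugeField (F.P Kt) k SU2, (∀ e : PBond (F.P Kt) k, e.src ∈ pts k Z → e.tgt ∈ pts k Z → W' e = W e) ∧
      ∀ e : PBond (F.P Kt) k, dist1 (W' e) ≤ ρn :=
    ⟨fun e => if e.src ∈ pts k Z ∧ e.tgt ∈ pts k Z then W e else 1, fun e hs ht => if_pos ⟨hs, ht⟩, fun e => by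
      show dist1 (if e.src ∈ pts k Z ∧ e.tgt ∈ pts k Z then W e else 1) ≤ ρn
      by_cases h : e.src ∈ pts k Z ∧ e.tgt ∈ pts k Z
      · rw [if_pos h]; exact hDZ e h.1 h.2
      · rw [if_neg h, GaugeGroup.dist1_one]; exact hρn⟩
  -- the surgered minimiser for the localised datum
  obtain ⟨U', hin, hmin'⟩ := exists_isMinimizer_surgery_far (N := 2) hM4 hk0 hk hdiv hZblk hWW' hmin
  -- the explicit letter of record at `N = 𝒞 = univ`
  obtain ⟨σ, hσ, hC1, hCin⟩ := exists_gaugeLetterLoc_atRecord_lamBondsSeq_explicit ν Kt hk0 hk hdiv Z hkc hc hMrad hρn W' (univ : Set (PBond (F.P Kt) k))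
    (fun e _ => hW' e) hmin' (univ : Set (PBond (F.P Kt) 0)) (fun _ _ _ _ => mem_univ _) (fun _ _ => ⟨mem_univ _, mem_univ _, mem_univ _, mem_univ _⟩)
    hεpos hα3 hα2 haN hM₁ (fun _ _ _ _ _ => mem_univ _)
  -- back to `U₀` on the bonds inside `Z`
  have hback : ∀ b : PBond (F.P Kt) 0, b.src ∈ Z → b.tgt ∈ Z → gaugeAct σ U' b = gaugeAct σ U₀ b := fun b hs ht => by
    show σ b.src * U' b * (σ b.tgt)⁻¹ = σ b.src * U₀ b * (σ b.tgt)⁻¹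
    rw [hin b hs ht]
  refine ⟨σ, hσ, fun p hp => ?_, fun b hs ht => ?_⟩
  · obtain ⟨h1, h2, h3, h4, h4'⟩ := corners_mem_of_sourced (Z := Z) hM4 hk0 hdiv p hp
    obtain ⟨c1, c2, c3, c4⟩ := hC1 p hp
    rw [hback ⟨p.src, p.μ⟩ h1 h2] at c1
    rw [hback ⟨p.src.shift p.μ, p.ν⟩ h2 h4] at c2
    rw [hback ⟨p.src.shift p.ν, p.μ⟩ h3 h4'] at c3
    rw [hback ⟨p.src, p.ν⟩ h1 h3] at c4
    exact ⟨c1, c2, c3, c4⟩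
  · have := hCin b (mem_univ _)
    rwa [hback b hs ht] at this

end Summit.QuantumFields.YangMills.BalabanUVNodes.N12GaugeLetterLocExplicitOnZLam

end
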